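import Summits.ABC.IUTFork.Repair.RHDiffPricedVsSlotReach
import Summits.ABC.IUTFork.Repair.RHSlotReachGlue
import HarnessLib

/-!
# R-H ROUND 1 (D-0079 «local-height condition I06⋆», D-0107), row 16 «diffpriced» — the END-TO-END k2 DOOR on the TAME-DIFFERENT stratum as ONE
# named theorem: `HStarDiffPriced D` (+ row 15's dictionary certificates) ⟹ `∃ ρ qK, QPinned ∧ PilotKummerCompatHull` at
# `settingPrVolSharp (pilotDataOfK D K) …` (the hSHw shape)

PROOF-ONLY composition file (D-0012: 0 definitions, 0 `Prop` facts; abc-iut cell, rung LADDER-ABC:A2.RESCUE.H; seat abc-iut-rh-typ-5 gen 2 = R-H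
ROUND 1 PAIR n = 5 TYPER, row 16 after row 5; the row-8 template is abc-iut-rh-typ-8's `Repair.RHHeightClassDoor`). NOTHING is proved here beyond a
composition BY NAME of two landed theorems: this seat's `RH.DiffPricedVsSlotReach.slotReachWindowK_of_hStarDiffPriced` (p464040: abc-iut-lens-transfer-3's
row-16 candidate `RH.DiffPriced.HStarDiffPriced D`, decl of record abc-iut-rp-s2's p458364, IMPLIES abc-iut-lens-wuc-1's row-15 `RHSlotReach.SlotReachWindowK D`
at the dictionary `n₀ ≡ 1`, `λ_p = −B_p/e_p`, `mΘ = j²·m_q` whenever the bad places have tame different `p ∤ e_w = e_p` and `B_p ≤ 1`) and abc-iut-rp-d3's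
`RHSlotReachGlue.exists_qPinned_and_hull_settingPrVolSharp_of_slotReachWindow` (p462301: the MOVER lemma `multiReach_of_slotReachWindow` proved ⟹ branch
C's antecedent at abc-iut-c312-7's `Thm311.Real.settingPrVolSharp`). SCOPE vs the earlier row-16 door `RH.DiffPricedVsTameBand.
exists_qPinned_and_hull_settingPrVolSharp_pilotDataOfK_of_hStarDiffPriced_of_tame` (p460055, shell-tame `e_w ≤ p − 2` via row 5): now EVERY place with
`p ∤ e_w`, the deep shells `e_w ≥ p` included (all 256 lamSeven groups of I06STAR-COLUMNS, every HEX-strip type with `l ≠ 7`, 751/801 frey groups);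
the wild half `p ∣ e_w` is not claimed (`DiffPricedVsSlotReach.wild_witness`). TAKES NO SIDE on [IUTchIII] Cor. 3.12 or on any author; `HStarDiffPriced` is a
HYPOTHESIS (claim-tagged), the dictionary certificates and idele-norm binders are hypotheses on the genuine bed exactly as in every door of record
(`Conditional.abc_of_SH_v10K_window` p447945's `hSHw` consumes the conclusion); typed ≠ proved; instantiated ≠ endorsed.
[cite: DupuyHilado2025, §3.9, §4.9] [cite: WeilBNT1967, Ch. II §2, Th. 1] [cite: SerreLocalFields1979, Ch. III §6 Prop. 13]
[claim: Mochizuki2012, status: disputed]. Axioms: standard.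
-/

noncomputable section

open Set Function
open scoped Pointwise

namespace Summit.ABC.IUTFork.Repair.RH.DiffPricedDoor

open Thm311 Thm311.Real Cor312 Cor312.Setting Cor312Vol Cor312Prov Literature.IUT.LogThetaLattice Literature.IUT.LogVolume
  Literature.IUT.HodgeTheaters
open Literature.NumberTheory.NumberFields NumberField IsDedekindDomain Metric Summit.ABC.IUTFork.Repair Summit.ABC.IUTFork.Repair.RH

section Setting

variable {F K Fbar : Type} [Field F] [NumberField F] [Field K] [NumberField K] [Algebra F K] [Field Fbar]
  [Algebra F Fbar] [Algebra K Fbar] {E : WeierstrassCurve F} [E.IsElliptic] {l : ℕ} {Pb : BadPlacePredicates K}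
  (D : InitialThetaData F K Fbar E l Pb) {logv : PadicLogs K} (hlog : LogvAnalytic logv)
  (M : Type) [Field M] [NumberField M]
  (archPk : ∀ (j : (thetaIndex (pilotDataOfK D K)).Label) (vQ : (thetaIndex (pilotDataOfK D K)).VQ), Set ((logShellsDH (pilotDataOfK D K) logv).Packet j vQ))
  (archSub : ∀ (j : (thetaIndex (pilotDataOfK D K)).Label) (v : (thetaIndex (pilotDataOfK D K)).V),
    Set ((logShellsDH (pilotDataOfK D K) logv).Packet j ((thetaIndex (pilotDataOfK D K)).over v)))
  (Ψ : ℤ → ∀ v : (thetaIndex (pilotDataOfK D K)).V, v ∈ (thetaIndex (pilotDataOfK D K)).Vbad → Set ((logShellsDH (pilotDataOfK D K) logv).StarPacket v))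
  (act : ℤ → ∀ v : (thetaIndex (pilotDataOfK D K)).V, v ∈ (thetaIndex (pilotDataOfK D K)).Vbad →
    (logShellsDH (pilotDataOfK D K) logv).StarPacket v → Module.End ℚ ((logShellsDH (pilotDataOfK D K) logv).StarPacket v))
  (Mmod : ℤ → ∀ j : (thetaIndex (pilotDataOfK D K)).LabelStar, Set ((logShellsDH (pilotDataOfK D K) logv).GlobalPacket j.1))
  (region : ℤ → ∀ j : (thetaIndex (pilotDataOfK D K)).LabelStar, FinDivisor M → ∀ vQ : (thetaIndex (pilotDataOfK D K)).VQ,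
    Set ((logShellsDH (pilotDataOfK D K) logv).Packet j.1 vQ))
  (n : ℤ) {HT : Type} {LogLink : HT → HT → Type} {IsFull : ∀ {s t : HT}, LogLink s t → Prop}
  (lat : LGPGaussianLogThetaLattice LogLink IsFull)
  {Frd : Type} {IsoF : Frd → Frd → Type} {Ob : Frd → Type} {realify : Frd → Frd} {Strip : Type}
  {IsoS : Strip → Strip → Type} {Mv : ∀ v : (thetaIndex (pilotDataOfK D K)).V, v ∈ (thetaIndex (pilotDataOfK D K)).Vbad → Type}
  [∀ v h, Monoid (Mv v h)]
  (sig : GlobalLGPFrobenioidSignature (thetaIndex (pilotDataOfK D K)).lstar (thetaIndex (pilotDataOfK D K)).V (· ∈ (thetaIndex (pilotDataOfK D K)).Vbad)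
    Frd IsoF Ob realify Strip IsoS Mv)
  (split : SplittingMonoids Mv) {ObΔ : Type} {N : ∀ v : (thetaIndex (pilotDataOfK D K)).V, v ∈ (thetaIndex (pilotDataOfK D K)).Vbad → Type}
  [∀ v h, Monoid (N v h)] (qData : QPilotData ObΔ N)
  (tq : ∀ (pp : Nat.Primes) (x : (thetaIndex (pilotDataOfK D K)).Fibre (.inr pp)), haveI : Fact (pp : ℕ).Prime := ⟨pp.2⟩; kOf (pilotDataOfK D K) pp.1 x)
  (t : ∀ (pp : Nat.Primes) (_ : Fin (pilotDataOfK D K).lstar) (x : (thetaIndex (pilotDataOfK D K)).Fibre (.inr pp)),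
    haveI : Fact (pp : ℕ).Prime := ⟨pp.2⟩; kOf (pilotDataOfK D K) pp.1 x)
  (htq0 : ∀ pp x, tq pp x ≠ 0)
  (htq1 : ∀ (pp : Nat.Primes) (x : (thetaIndex (pilotDataOfK D K)).Fibre (.inr pp)),
    haveI : Fact (pp : ℕ).Prime := ⟨pp.2⟩; placeOf (pilotDataOfK D K) pp.1 x ∉ (pilotDataOfK D K).S → ‖tq pp x‖ = 1)
  (col : ℤ → Column (logShellsDH (pilotDataOfK D K) logv))
  -- row 16's DATUM-LEVEL dictionary read through row 15: per prime `p` ONE ramification index `e_p` (uniform bad fibres, `p ∤ e_p`) and ONE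
  -- outer exponent `B_p ≤ 1` (untied `r_out♯`), a norm uniformizer per place, and the integer idele orders
  (eK : Nat.Primes → ℕ) (BK : Nat.Primes → ℤ)
  (ϖ : ∀ (pp : Nat.Primes) (x : (thetaIndex (pilotDataOfK D K)).Fibre (.inr pp)), haveI : Fact (pp : ℕ).Prime := ⟨pp.2⟩; kOf (pilotDataOfK D K) pp.1 x)
  (mq : ∀ pp : Nat.Primes, (thetaIndex (pilotDataOfK D K)).Fibre (.inr pp) → ℤ)

/-- **ROW 16's k2 DOOR ON THE TAME-DIFFERENT STRATUM, END TO END.** At the genuine `K`-level datum `pilotDataOfK D K` and the print-normalised sharp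
setting `settingPrVolSharp (pilotDataOfK D K) …`: if abc-iut-lens-transfer-3's ROUND-1 row-16 candidate `RH.DiffPriced.HStarDiffPriced D` (p458364) holds,
then — given the dictionary read through row 15 (every BAD place `w ∣ p` has `e_w = e_p` with `p ∤ e_p`, i.e. TAME DIFFERENT, deep shells `e_p ≥ p`
INCLUDED; an outer exponent `B_p ≤ 1` under the bad places, e.g. the untied `r_out♯` by `RHHeightClass.strictMinPow_le_one`), the two per-place
certificates of the row-15 window at `(n₀, λ) = (1, −B_p/e_p)` (a non-log-unit of norm `≤ 1`: `RHSlotReach.exists_hsharp_one`; a log-unit of norm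
`≥ p^{−B_p/e_p}`: `RHSlotReach.exists_hrad_sharp` untied), norm uniformizers `‖ϖ_x‖ = p^{−1/e_p}`, and the honest idele profile (`‖t_{q,w}‖ = ‖ϖ_w‖^{m_q(w)}`,
`‖t_{Θ,j,w}‖ = ‖ϖ_w‖^{j²·m_q(w)}`, `m_q(w) = P_q(w)` at bad `w`, `‖t‖ = 1` off `S`, `‖t_q‖ ≤ 1`) — branch C's antecedent holds:
`∃ ρ qK, QPinned ∧ PilotKummerCompatHull`, the binder `hSHw` of the window certificates (START-HERE §8 A2 (a) target shape). PROOF = this seat's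
`DiffPricedVsSlotReach.slotReachWindowK_of_hStarDiffPriced` (p464040) fed to abc-iut-rp-d3's `RHSlotReachGlue.exists_qPinned_and_hull_settingPrVolSharp_of_slotReachWindow`
(p462301, mover proved); nothing else. This EXTENDS the row-16 door of p460055 (shell-tame `e_w ≤ p − 2` only, via row 5) to every `p ∤ e_w`; the WILD
half `p ∣ e_w` is NOT claimed (`DiffPricedVsSlotReach.wild_witness`). [cite: DupuyHilado2025, §3.9, §4.9] [cite: WeilBNT1967, Ch. II §2, Th. 1]
[cite: SerreLocalFields1979, Ch. III §6 Prop. 13] [claim: Mochizuki2012, status: disputed] -/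
theorem exists_qPinned_and_hull_settingPrVolSharp_pilotDataOfK_of_hStarDiffPriced (htqle : ∀ pp x, ‖tq pp x‖ ≤ 1)
    (heK : ∀ pp, 1 ≤ eK pp)
    (hram : ∀ (pp : Nat.Primes) (w : (thetaIndex (pilotDataOfK D K)).Fibre (.inr pp)), haveI : Fact (pp : ℕ).Prime := ⟨pp.2⟩
      placeOf (pilotDataOfK D K) pp.1 w ∈ (pilotDataOfK D K).S → (placeOf (pilotDataOfK D K) pp.1 w).asIdeal.ramificationIdx ℤ = eK pp)
    (hnd : ∀ (pp : Nat.Primes) (w : (thetaIndex (pilotDataOfK D K)).Fibre (.inr pp)), haveI : Fact (pp : ℕ).Prime := ⟨pp.2⟩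
      placeOf (pilotDataOfK D K) pp.1 w ∈ (pilotDataOfK D K).S → ¬ (pp : ℕ) ∣ eK pp)
    (hBK : ∀ (pp : Nat.Primes) (w : (thetaIndex (pilotDataOfK D K)).Fibre (.inr pp)), haveI : Fact (pp : ℕ).Prime := ⟨pp.2⟩
      placeOf (pilotDataOfK D K) pp.1 w ∈ (pilotDataOfK D K).S → BK pp ≤ 1)
    (hϖ : ∀ (pp : Nat.Primes) (x : (thetaIndex (pilotDataOfK D K)).Fibre (.inr pp)), haveI : Fact (pp : ℕ).Prime := ⟨pp.2⟩
      ‖ϖ pp x‖ = (pp : ℝ) ^ (-(1 : ℝ) / ((eK pp : ℕ) : ℝ)))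
    (hsharp : ∀ (pp : Nat.Primes) (x : (thetaIndex (pilotDataOfK D K)).Fibre (.inr pp)), haveI : Fact (pp : ℕ).Prime := ⟨pp.2⟩
      ∃ u : kOf (pilotDataOfK D K) pp.1 x, ‖u‖ ≤ ‖ϖ pp x‖ ^ (((1 : ℕ) : ℤ) - 1) ∧ u ∉ (logUnits (kOf (pilotDataOfK D K) pp.1 x) : Set (kOf (pilotDataOfK D K) pp.1 x)))
    (hrad : ∀ (pp : Nat.Primes) (x : (thetaIndex (pilotDataOfK D K)).Fibre (.inr pp)), haveI : Fact (pp : ℕ).Prime := ⟨pp.2⟩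
      ∃ z ∈ (logUnits (kOf (pilotDataOfK D K) pp.1 x) : Set (kOf (pilotDataOfK D K) pp.1 x)), (pp : ℝ) ^ (-((BK pp : ℤ) : ℝ) / ((eK pp : ℕ) : ℝ)) ≤ ‖z‖)
    (ht1 : ∀ (pp : Nat.Primes) (i : Fin (pilotDataOfK D K).lstar) (x : (thetaIndex (pilotDataOfK D K)).Fibre (.inr pp)),
      haveI : Fact (pp : ℕ).Prime := ⟨pp.2⟩; placeOf (pilotDataOfK D K) pp.1 x ∉ (pilotDataOfK D K).S → ‖t pp i x‖ = 1)
    (hΘ : ∀ (pp : Nat.Primes) (i : Fin (pilotDataOfK D K).lstar) (w : (thetaIndex (pilotDataOfK D K)).Fibre (.inr pp)), haveI : Fact (pp : ℕ).Prime := ⟨pp.2⟩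
      placeOf (pilotDataOfK D K) pp.1 w ∈ (pilotDataOfK D K).S → ‖t pp i w‖ = ‖ϖ pp w‖ ^ ((((((i : ℕ) : ℤ) + 1) ^ 2) * mq pp w)))
    (hq : ∀ (pp : Nat.Primes) (w : (thetaIndex (pilotDataOfK D K)).Fibre (.inr pp)), haveI : Fact (pp : ℕ).Prime := ⟨pp.2⟩
      placeOf (pilotDataOfK D K) pp.1 w ∈ (pilotDataOfK D K).S → ‖tq pp w‖ = ‖ϖ pp w‖ ^ (mq pp w))
    (hmq : ∀ (pp : Nat.Primes) (w : (thetaIndex (pilotDataOfK D K)).Fibre (.inr pp)), haveI : Fact (pp : ℕ).Prime := ⟨pp.2⟩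
      placeOf (pilotDataOfK D K) pp.1 w ∈ (pilotDataOfK D K).S → (mq pp w : ℝ) = (pilotDataOfK D K).qPilot (placeOf (pilotDataOfK D K) pp.1 w))
    (hH : DiffPriced.HStarDiffPriced D) :
    ∃ (ρ : (∀ v : (thetaIndex (pilotDataOfK D K)).V, v ∈ (thetaIndex (pilotDataOfK D K)).Vbad → Set ((logShellsDH (pilotDataOfK D K) logv).StarPacket v)) →
          ∀ (j : (thetaIndex (pilotDataOfK D K)).Label) (vQ : (thetaIndex (pilotDataOfK D K)).VQ), Set ((logShellsDH (pilotDataOfK D K) logv).Packet j vQ))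
        (qK : ∀ v : (thetaIndex (pilotDataOfK D K)).V, v ∈ (thetaIndex (pilotDataOfK D K)).Vbad → Set ((logShellsDH (pilotDataOfK D K) logv).StarPacket v)),
        QPinned ({ toSituation := situationPrVol (pilotDataOfK D K) hlog M archPk archSub Ψ act Mmod region, col := col } :
            LatticeSituation (thetaIndex (pilotDataOfK D K)))
          (settingPrVolSharp (pilotDataOfK D K) hlog M archPk archSub Ψ act Mmod region n lat sig split qData tq t htq0 htq1) ρ qK ∧
        PilotKummerCompatHull ({ toSituation := situationPrVol (pilotDataOfK D K) hlog M archPk archSub Ψ act Mmod region, col := col } :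
            LatticeSituation (thetaIndex (pilotDataOfK D K)))
          (settingPrVolSharp (pilotDataOfK D K) hlog M archPk archSub Ψ act Mmod region n lat sig split qData tq t htq0 htq1) ρ qK := by
  -- the window of row 15 at row 16's dictionary (this seat, p464040)
  have hW := DiffPricedVsSlotReach.slotReachWindowK_of_hStarDiffPriced D eK BK heK
    (fun pp _ => eK pp) (fun _ _ => 1) (fun pp _ => -((BK pp : ℤ) : ℝ) / ((eK pp : ℕ) : ℝ))
    (fun pp i w => ((((i : ℕ) : ℤ) + 1) ^ 2) * mq pp w) mq
    (fun _ _ => rfl) (fun _ _ => rfl) (fun _ _ => rfl) (fun _ _ _ => rfl) hram hnd hmq hBK hH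
  -- fed to the mover door (abc-iut-rp-d3, RHSlotReachGlue p462301); `SlotReachWindowK` unfolds to its `hH` binder (`slotReachWindowK_iff`)
  exact RHSlotReachGlue.exists_qPinned_and_hull_settingPrVolSharp_of_slotReachWindow (pilotDataOfK D K) hlog M archPk archSub Ψ act Mmod
    region n lat sig split qData tq t htq0 htq1 col (fun pp _ => eK pp) (fun _ _ => 1)
    (fun pp _ => -((BK pp : ℤ) : ℝ) / ((eK pp : ℕ) : ℝ)) ϖ (fun pp i w => ((((i : ℕ) : ℤ) + 1) ^ 2) * mq pp w) mq htqle
    (fun pp _ => heK pp) hϖ hsharp hrad ht1 hΘ hq ((RHSlotReach.slotReachWindowK_iff D _ _ _ _ _).1 hW)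

end Setting

end Summit.ABC.IUTFork.Repair.RH.DiffPricedDoor

end

/-! ## §2. (APPENDED 2026-08-26, v2) The door under abc-iut-rh-tst-5's CHECKABLE-COLUMN side condition «δ_w + B_p ≤ e_p» — wild places included

§1 asks `p ∤ e_w` (tame different). abc-iut-rh-tst-5 g2 (STATUS 19:25:15Z, `win_of_cell_of_add_le`) observed that the arithmetic only needs
`δ_w + B ≤ e_w` with `δ_w` the different exponent and `B ≤ 1` the outer exponent — a condition between three COLUMNS of the table, satisfied with
equality at tame places and with room at the HEX-type wild places (`r_out♯ ≪ 0`). This section is the corresponding END-TO-END door; §1 is its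
special case `δ_w = e_w − 1`. -/

namespace Summit.ABC.IUTFork.Repair.RH.DiffPricedDoor

open Thm311 Thm311.Real Cor312 Cor312.Setting Cor312Vol Cor312Prov Literature.IUT.LogThetaLattice Literature.IUT.LogVolume
  Literature.IUT.HodgeTheaters
open Literature.NumberTheory.NumberFields NumberField IsDedekindDomain Metric Summit.ABC.IUTFork.Repair Summit.ABC.IUTFork.Repair.RH
open Literature.NumberTheory.GaloisRepresentations.Ultrametric

section SettingColumn

variable {F K Fbar : Type} [Field F] [NumberField F] [Field K] [NumberField K] [Algebra F K] [Field Fbar]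
  [Algebra F Fbar] [Algebra K Fbar] {E : WeierstrassCurve F} [E.IsElliptic] {l : ℕ} {Pb : BadPlacePredicates K}
  (D : InitialThetaData F K Fbar E l Pb) {logv : PadicLogs K} (hlog : LogvAnalytic logv)
  (M : Type) [Field M] [NumberField M]
  (archPk : ∀ (j : (thetaIndex (pilotDataOfK D K)).Label) (vQ : (thetaIndex (pilotDataOfK D K)).VQ), Set ((logShellsDH (pilotDataOfK D K) logv).Packet j vQ))
  (archSub : ∀ (j : (thetaIndex (pilotDataOfK D K)).Label) (v : (thetaIndex (pilotDataOfK D K)).V),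
    Set ((logShellsDH (pilotDataOfK D K) logv).Packet j ((thetaIndex (pilotDataOfK D K)).over v)))
  (Ψ : ℤ → ∀ v : (thetaIndex (pilotDataOfK D K)).V, v ∈ (thetaIndex (pilotDataOfK D K)).Vbad → Set ((logShellsDH (pilotDataOfK D K) logv).StarPacket v))
  (act : ℤ → ∀ v : (thetaIndex (pilotDataOfK D K)).V, v ∈ (thetaIndex (pilotDataOfK D K)).Vbad →
    (logShellsDH (pilotDataOfK D K) logv).StarPacket v → Module.End ℚ ((logShellsDH (pilotDataOfK D K) logv).StarPacket v))
  (Mmod : ℤ → ∀ j : (thetaIndex (pilotDataOfK D K)).LabelStar, Set ((logShellsDH (pilotDataOfK D K) logv).GlobalPacket j.1))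
  (region : ℤ → ∀ j : (thetaIndex (pilotDataOfK D K)).LabelStar, FinDivisor M → ∀ vQ : (thetaIndex (pilotDataOfK D K)).VQ,
    Set ((logShellsDH (pilotDataOfK D K) logv).Packet j.1 vQ))
  (n : ℤ) {HT : Type} {LogLink : HT → HT → Type} {IsFull : ∀ {s t : HT}, LogLink s t → Prop}
  (lat : LGPGaussianLogThetaLattice LogLink IsFull)
  {Frd : Type} {IsoF : Frd → Frd → Type} {Ob : Frd → Type} {realify : Frd → Frd} {Strip : Type}
  {IsoS : Strip → Strip → Type} {Mv : ∀ v : (thetaIndex (pilotDataOfK D K)).V, v ∈ (thetaIndex (pilotDataOfK D K)).Vbad → Type}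
  [∀ v h, Monoid (Mv v h)]
  (sig : GlobalLGPFrobenioidSignature (thetaIndex (pilotDataOfK D K)).lstar (thetaIndex (pilotDataOfK D K)).V (· ∈ (thetaIndex (pilotDataOfK D K)).Vbad)
    Frd IsoF Ob realify Strip IsoS Mv)
  (split : SplittingMonoids Mv) {ObΔ : Type} {N : ∀ v : (thetaIndex (pilotDataOfK D K)).V, v ∈ (thetaIndex (pilotDataOfK D K)).Vbad → Type}
  [∀ v h, Monoid (N v h)] (qData : QPilotData ObΔ N)
  (tq : ∀ (pp : Nat.Primes) (x : (thetaIndex (pilotDataOfK D K)).Fibre (.inr pp)), haveI : Fact (pp : ℕ).Prime := ⟨pp.2⟩; kOf (pilotDataOfK D K) pp.1 x)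
  (t : ∀ (pp : Nat.Primes) (_ : Fin (pilotDataOfK D K).lstar) (x : (thetaIndex (pilotDataOfK D K)).Fibre (.inr pp)),
    haveI : Fact (pp : ℕ).Prime := ⟨pp.2⟩; kOf (pilotDataOfK D K) pp.1 x)
  (htq0 : ∀ pp x, tq pp x ≠ 0)
  (htq1 : ∀ (pp : Nat.Primes) (x : (thetaIndex (pilotDataOfK D K)).Fibre (.inr pp)),
    haveI : Fact (pp : ℕ).Prime := ⟨pp.2⟩; placeOf (pilotDataOfK D K) pp.1 x ∉ (pilotDataOfK D K).S → ‖tq pp x‖ = 1)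
  (col : ℤ → Column (logShellsDH (pilotDataOfK D K) logv))
  -- row 16's DATUM-LEVEL dictionary read through row 15: per prime `p` ONE ramification index `e_p` (uniform bad fibres, `p ∤ e_p`) and ONE
  -- outer exponent `B_p ≤ 1` (untied `r_out♯`), a norm uniformizer per place, and the integer idele orders
  (eK : Nat.Primes → ℕ) (BK : Nat.Primes → ℤ)
  (ϖ : ∀ (pp : Nat.Primes) (x : (thetaIndex (pilotDataOfK D K)).Fibre (.inr pp)), haveI : Fact (pp : ℕ).Prime := ⟨pp.2⟩; kOf (pilotDataOfK D K) pp.1 x)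
  (mq : ∀ pp : Nat.Primes, (thetaIndex (pilotDataOfK D K)).Fibre (.inr pp) → ℤ)

/-- **ROW 16's k2 DOOR UNDER THE COLUMN CONDITION «δ_w + B_p ≤ e_p», END TO END (wild places INCLUDED).** Same bed, same dictionary and
certificates as §1, with the stratum hypotheses «`e_w = e_p`, `p ∤ e_p`» REPLACED by abc-iut-rh-tst-5's single checkable inequality at every bad
place: `e(K_w/ℚ_p)·differentOrd p K_w + B_p ≤ e_p` (different exponent col 14 + outer exponent `R_out♯` ≤ ramification index; tame: equality).
Then `HStarDiffPriced D ⟹ ∃ ρ qK, QPinned ∧ PilotKummerCompatHull` at `settingPrVolSharp (pilotDataOfK D K) …`. PROOF =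
`DiffPricedVsSlotReach.slotReachWindowK_of_hStarDiffPriced_of_diff_add_outer_le` (v2) fed to abc-iut-rp-d3's p462301; nothing else. On the rows of
record the condition holds on 2699/2700 (row, δ-end) pairs of WINDOW-TABLE v4.9 and on 48/48 of row 16's slice (abc-iut-rh-tst-5 19:25:15Z).
[cite: DupuyHilado2025, §3.9, §4.9] [cite: WeilBNT1967, Ch. II §2, Th. 1] [cite: Mochizuki2012, IUTchIV Prop. 1.1 p. 9]
[claim: Mochizuki2012, status: disputed] -/
theorem exists_qPinned_and_hull_settingPrVolSharp_pilotDataOfK_of_hStarDiffPriced_of_diff_add_outer_le (htqle : ∀ pp x, ‖tq pp x‖ ≤ 1)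
    (heK : ∀ pp, 1 ≤ eK pp)
    (hdiff : ∀ (pp : Nat.Primes) (w : (thetaIndex (pilotDataOfK D K)).Fibre (.inr pp)), haveI : Fact (pp : ℕ).Prime := ⟨pp.2⟩
      placeOf (pilotDataOfK D K) pp.1 w ∈ (pilotDataOfK D K).S →
        (absRamificationIdx (pp : ℕ) (kOf (pilotDataOfK D K) pp.1 w) : ℝ) * differentOrd (pp : ℕ) (kOf (pilotDataOfK D K) pp.1 w)
          + ((BK pp : ℤ) : ℝ) ≤ ((eK pp : ℕ) : ℝ))
    (hBK : ∀ (pp : Nat.Primes) (w : (thetaIndex (pilotDataOfK D K)).Fibre (.inr pp)), haveI : Fact (pp : ℕ).Prime := ⟨pp.2⟩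
      placeOf (pilotDataOfK D K) pp.1 w ∈ (pilotDataOfK D K).S → BK pp ≤ 1)
    (hϖ : ∀ (pp : Nat.Primes) (x : (thetaIndex (pilotDataOfK D K)).Fibre (.inr pp)), haveI : Fact (pp : ℕ).Prime := ⟨pp.2⟩
      ‖ϖ pp x‖ = (pp : ℝ) ^ (-(1 : ℝ) / ((eK pp : ℕ) : ℝ)))
    (hsharp : ∀ (pp : Nat.Primes) (x : (thetaIndex (pilotDataOfK D K)).Fibre (.inr pp)), haveI : Fact (pp : ℕ).Prime := ⟨pp.2⟩
      ∃ u : kOf (pilotDataOfK D K) pp.1 x, ‖u‖ ≤ ‖ϖ pp x‖ ^ (((1 : ℕ) : ℤ) - 1) ∧ u ∉ (logUnits (kOf (pilotDataOfK D K) pp.1 x) : Set (kOf (pilotDataOfK D K) pp.1 x)))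
    (hrad : ∀ (pp : Nat.Primes) (x : (thetaIndex (pilotDataOfK D K)).Fibre (.inr pp)), haveI : Fact (pp : ℕ).Prime := ⟨pp.2⟩
      ∃ z ∈ (logUnits (kOf (pilotDataOfK D K) pp.1 x) : Set (kOf (pilotDataOfK D K) pp.1 x)), (pp : ℝ) ^ (-((BK pp : ℤ) : ℝ) / ((eK pp : ℕ) : ℝ)) ≤ ‖z‖)
    (ht1 : ∀ (pp : Nat.Primes) (i : Fin (pilotDataOfK D K).lstar) (x : (thetaIndex (pilotDataOfK D K)).Fibre (.inr pp)),
      haveI : Fact (pp : ℕ).Prime := ⟨pp.2⟩; placeOf (pilotDataOfK D K) pp.1 x ∉ (pilotDataOfK D K).S → ‖t pp i x‖ = 1)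
    (hΘ : ∀ (pp : Nat.Primes) (i : Fin (pilotDataOfK D K).lstar) (w : (thetaIndex (pilotDataOfK D K)).Fibre (.inr pp)), haveI : Fact (pp : ℕ).Prime := ⟨pp.2⟩
      placeOf (pilotDataOfK D K) pp.1 w ∈ (pilotDataOfK D K).S → ‖t pp i w‖ = ‖ϖ pp w‖ ^ ((((((i : ℕ) : ℤ) + 1) ^ 2) * mq pp w)))
    (hq : ∀ (pp : Nat.Primes) (w : (thetaIndex (pilotDataOfK D K)).Fibre (.inr pp)), haveI : Fact (pp : ℕ).Prime := ⟨pp.2⟩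
      placeOf (pilotDataOfK D K) pp.1 w ∈ (pilotDataOfK D K).S → ‖tq pp w‖ = ‖ϖ pp w‖ ^ (mq pp w))
    (hmq : ∀ (pp : Nat.Primes) (w : (thetaIndex (pilotDataOfK D K)).Fibre (.inr pp)), haveI : Fact (pp : ℕ).Prime := ⟨pp.2⟩
      placeOf (pilotDataOfK D K) pp.1 w ∈ (pilotDataOfK D K).S → (mq pp w : ℝ) = (pilotDataOfK D K).qPilot (placeOf (pilotDataOfK D K) pp.1 w))
    (hH : DiffPriced.HStarDiffPriced D) :
    ∃ (ρ : (∀ v : (thetaIndex (pilotDataOfK D K)).V, v ∈ (thetaIndex (pilotDataOfK D K)).Vbad → Set ((logShellsDH (pilotDataOfK D K) logv).StarPacket v)) →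
          ∀ (j : (thetaIndex (pilotDataOfK D K)).Label) (vQ : (thetaIndex (pilotDataOfK D K)).VQ), Set ((logShellsDH (pilotDataOfK D K) logv).Packet j vQ))
        (qK : ∀ v : (thetaIndex (pilotDataOfK D K)).V, v ∈ (thetaIndex (pilotDataOfK D K)).Vbad → Set ((logShellsDH (pilotDataOfK D K) logv).StarPacket v)),
        QPinned ({ toSituation := situationPrVol (pilotDataOfK D K) hlog M archPk archSub Ψ act Mmod region, col := col } :
            LatticeSituation (thetaIndex (pilotDataOfK D K)))
          (settingPrVolSharp (pilotDataOfK D K) hlog M archPk archSub Ψ act Mmod region n lat sig split qData tq t htq0 htq1) ρ qK ∧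
        PilotKummerCompatHull ({ toSituation := situationPrVol (pilotDataOfK D K) hlog M archPk archSub Ψ act Mmod region, col := col } :
            LatticeSituation (thetaIndex (pilotDataOfK D K)))
          (settingPrVolSharp (pilotDataOfK D K) hlog M archPk archSub Ψ act Mmod region n lat sig split qData tq t htq0 htq1) ρ qK := by
  -- the window of row 15 under the column condition (this file's companion, RHDiffPricedVsSlotReach §5 v2)
  have hW := DiffPricedVsSlotReach.slotReachWindowK_of_hStarDiffPriced_of_diff_add_outer_le D eK BK heK
    (fun pp _ => eK pp) (fun _ _ => 1) (fun pp _ => -((BK pp : ℤ) : ℝ) / ((eK pp : ℕ) : ℝ))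
    (fun pp i w => ((((i : ℕ) : ℤ) + 1) ^ 2) * mq pp w) mq
    (fun _ _ => rfl) (fun _ _ => rfl) (fun _ _ => rfl) (fun _ _ _ => rfl) hmq hBK hdiff hH
  exact RHSlotReachGlue.exists_qPinned_and_hull_settingPrVolSharp_of_slotReachWindow (pilotDataOfK D K) hlog M archPk archSub Ψ act Mmod
    region n lat sig split qData tq t htq0 htq1 col (fun pp _ => eK pp) (fun _ _ => 1)
    (fun pp _ => -((BK pp : ℤ) : ℝ) / ((eK pp : ℕ) : ℝ)) ϖ (fun pp i w => ((((i : ℕ) : ℤ) + 1) ^ 2) * mq pp w) mq htqle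
    (fun pp _ => heK pp) hϖ hsharp hrad ht1 hΘ hq ((RHSlotReach.slotReachWindowK_iff D _ _ _ _ _).1 hW)

end SettingColumn

end Summit.ABC.IUTFork.Repair.RH.DiffPricedDoor
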